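import Summits.Ventures.PercRepro2.CaseOnePendantPathRoots

/-!
# Pendant trees: the four case-1 forms at every vertex of a pendant tree of any shape
(blind cell PercRepro2, p1 g22; S5 §2.1 (K9): the pendant lemma K8 and its Q-side, iterated over a
tree-building relation)

`CaseOnePendantPath` propagates the four forms `(ii)`, `(ii-Q)`, `(i)`, `(i-Q)` along ONE pendant path.
Here the path is replaced by a pendant TREE of any shape: `IsPendantTreeAt P o a₁ a₂ b n E ends v S` says
that the vertex set `S` is grown from the anchor `v` by attaching `n` leaves one at a time, each new leaf
`a₃` (avoiding the marks, not yet in the set) hanging at ANY vertex `x` already in the set, the anchor `v`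
satisfying the structural predicate `P` in the graph with the whole tree deleted. Several branches may
hang at one vertex, branches may branch again — every finite tree rooted at `v` arises.
**`fourForms_of_pendantTree`**: if `P` forces the four forms at the anchor in every finite graph, then
EVERY vertex of the tree has the four forms in `G`, for every weight vector — by induction on `n`: the
forms at the old vertices are kept through the leaf-deletion transfer (`CaseOneLeafDelete`: a leaf edge
elsewhere changes no case-1 quantity at a vertex `≠ a₃`), and the new leaf gets them from its attachment
vertex by K8 and the Q-side (`*_of_leaf_at`). Corollaries: `(J1₁)`, `(J1)` (with the mirrored anchor
predicate) and `(RV)` at every tree vertex, the pendant paths as the trees with one branch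
(`IsPendantTreeAt.of_pendantPath`), and the instances at the four closed anchors — marked star, uwob
gadget, roots-only, roots-and-`o` (`*_of_pendantTree_markedStar`, `…_gadgetUWOB`, `…_rootsOnly`,
`…_rootsAndO`): every row of the class table at every vertex of every pendant tree hanging at such a
vertex. Own code; standard axioms. -/

namespace Summit.Ventures.PercRepro2

namespace CaseOne

universe u

section TreeDef
variable {V : Type*}

/-- **A pendant tree of `n` edges grown at the anchor `v`, with vertex set `S`, avoiding the marks, whose
anchor satisfies `P` in the graph with the tree deleted**: `n = 0` means `S = {v}` and `P E ends v`;
`n + 1` means the last leaf `a₃ ∉ {o, a₁, a₂, b}` hangs through `e₀` at a vertex `x` of the smaller tree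
`S'` (with `a₃ ∉ S'`, `S = insert a₃ S'`), and in `G − e₀` the set `S'` is a pendant tree of `n` edges at
`v`. -/
def IsPendantTreeAt (P : (E : Type u) → (E → Sym2 V) → V → Prop) (o a₁ a₂ b : V) :
    (n : ℕ) → (E : Type u) → [Fintype E] → [DecidableEq E] → (E → Sym2 V) → V → Set V → Prop
  | 0, E, _, _, ends, v, S => S = {v} ∧ P E ends v
  | n + 1, E, _, _, ends, v, S => ∃ (x a₃ : V) (e₀ : E) (S' : Set V), IsLeafAt ends x a₃ e₀ ∧
      o ≠ a₃ ∧ a₁ ≠ a₃ ∧ a₂ ≠ a₃ ∧ b ≠ a₃ ∧ x ∈ S' ∧ a₃ ∉ S' ∧ S = insert a₃ S' ∧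
      IsPendantTreeAt P o a₁ a₂ b n {e : E // e ≠ e₀} (restrictEnds ends e₀) v S'

/-- The roots of the marks can be swapped in a pendant-tree predicate. -/
theorem IsPendantTreeAt.swap (P : (E : Type u) → (E → Sym2 V) → V → Prop) (o a₁ a₂ b : V) :
    ∀ (n : ℕ) (E : Type u) [Fintype E] [DecidableEq E] (ends : E → Sym2 V) (v : V) (S : Set V),
      IsPendantTreeAt P o a₁ a₂ b n E ends v S → IsPendantTreeAt P o a₂ a₁ b n E ends v S := by
  intro n
  induction n with
  | zero =>
    intro E _ _ ends v S h
    exact h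
  | succ n ih =>
    intro E _ _ ends v S h
    obtain ⟨x, a₃, e₀, S', hl, ho, h1, h2, hb, hx, ha₃, hS, htree⟩ := h
    exact ⟨x, a₃, e₀, S', hl, ho, h2, h1, hb, hx, ha₃, hS, ih _ _ v S' htree⟩

/-- The anchor belongs to its pendant tree. -/
theorem IsPendantTreeAt.anchor_mem (P : (E : Type u) → (E → Sym2 V) → V → Prop) (o a₁ a₂ b : V) :
    ∀ (n : ℕ) (E : Type u) [Fintype E] [DecidableEq E] (ends : E → Sym2 V) (v : V) (S : Set V),
      IsPendantTreeAt P o a₁ a₂ b n E ends v S → v ∈ S := by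
  intro n
  induction n with
  | zero =>
    intro E _ _ ends v S h
    rw [h.1]
    exact Set.mem_singleton v
  | succ n ih =>
    intro E _ _ ends v S h
    obtain ⟨x, a₃, e₀, S', -, -, -, -, -, -, -, rfl, htree⟩ := h
    exact Set.mem_insert_of_mem a₃ (ih _ _ v S' htree)

/-- Every vertex of a pendant tree other than the anchor has an edge (it was attached as a leaf). -/
theorem IsPendantTreeAt.exists_edge (P : (E : Type u) → (E → Sym2 V) → V → Prop) (o a₁ a₂ b : V) :
    ∀ (n : ℕ) (E : Type u) [Fintype E] [DecidableEq E] (ends : E → Sym2 V) (v : V) (S : Set V),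
      IsPendantTreeAt P o a₁ a₂ b n E ends v S → ∀ y ∈ S, y ≠ v → ∃ e, y ∈ ends e := by
  intro n
  induction n with
  | zero =>
    intro E _ _ ends v S h y hy hne
    rw [h.1] at hy
    exact absurd hy hne
  | succ n ih =>
    intro E _ _ ends v S h y hy hne
    obtain ⟨x, a₃, e₀, S', hl, -, -, -, -, -, -, rfl, htree⟩ := h
    rcases Set.mem_insert_iff.1 hy with hya | hy'
    · refine ⟨e₀, ?_⟩
      rw [hya, hl.ends_eq]
      exact Sym2.mem_mk_right x a₃
    · obtain ⟨e, he⟩ := ih _ _ v S' htree y hy' hne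
      exact ⟨e.1, he⟩

/-- The anchor of a pendant tree has an edge whenever the anchor predicate gives it one. -/
theorem IsPendantTreeAt.anchor_edge (P : (E : Type u) → (E → Sym2 V) → V → Prop) (o a₁ a₂ b : V)
    (hPedge : ∀ (E : Type u) (ends : E → Sym2 V) (v : V), P E ends v → ∃ e, v ∈ ends e) :
    ∀ (n : ℕ) (E : Type u) [Fintype E] [DecidableEq E] (ends : E → Sym2 V) (v : V) (S : Set V),
      IsPendantTreeAt P o a₁ a₂ b n E ends v S → ∃ e, v ∈ ends e := by
  intro n
  induction n with
  | zero =>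
    intro E _ _ ends v S h
    exact hPedge E ends v h.2
  | succ n ih =>
    intro E _ _ ends v S h
    obtain ⟨x, a₃, e₀, S', -, -, -, -, -, -, -, -, htree⟩ := h
    obtain ⟨e, he⟩ := ih _ _ v S' htree
    exact ⟨e.1, he⟩

end TreeDef

section TreeTheorem
variable {V : Type*} {R : Type*} [CommRing R] [LinearOrder R] [IsStrictOrderedRing R]

/-- **The four forms at every vertex of a pendant tree**: if the anchor predicate `P` forces `(ii)`,
`(ii-Q)`, `(i)`, `(i-Q)` at the anchor in every finite graph, then every vertex `y` of a pendant tree of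
`n` edges at such an anchor has the four forms in `G`, for every weight vector. Induction on `n`: the
old vertices keep the forms through the leaf-deletion transfer, the new leaf gets them by K8 and its
Q-side from its attachment vertex. -/
theorem fourForms_of_pendantTree (P : (E : Type u) → (E → Sym2 V) → V → Prop) (o a₁ a₂ b : V)
    (hP : ∀ (E : Type u) [Fintype E] [DecidableEq E] (ends : E → Sym2 V) (p : E → R), IsProbVec p →
      ∀ v, P E ends v → FourForms p ends o a₁ a₂ v b) :
    ∀ (n : ℕ) (E : Type u) [Fintype E] [DecidableEq E] (ends : E → Sym2 V) (p : E → R), IsProbVec p →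
      ∀ (v : V) (S : Set V), IsPendantTreeAt P o a₁ a₂ b n E ends v S →
        ∀ y ∈ S, FourForms p ends o a₁ a₂ y b := by
  intro n
  induction n with
  | zero =>
    intro E _ _ ends p hp v S h y hy
    obtain ⟨rfl, hPv⟩ := h
    rw [Set.mem_singleton_iff] at hy
    rw [hy]
    exact hP E ends p hp v hPv
  | succ n ih =>
    intro E _ _ ends p hp v S h y hy
    obtain ⟨x, a₃, e₀, S', hl, ho, h1, h2, hb, hx, ha₃, rfl, htree⟩ := h
    have ih' : ∀ z ∈ S', FourForms (restrictW p e₀) (restrictEnds ends e₀) o a₁ a₂ z b :=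
      ih {e : E // e ≠ e₀} (restrictEnds ends e₀) (restrictW p e₀) (IsProbVec.restrictW hp e₀) v S' htree
    -- the old vertices keep the four forms: a leaf edge elsewhere changes nothing at `z ≠ a₃`
    have hold : ∀ z ∈ S', FourForms p ends o a₁ a₂ z b := by
      intro z hz
      have hz' := ih' z hz
      have hne : z ≠ a₃ := fun hzeq => ha₃ (hzeq ▸ hz)
      exact ⟨zSplitII_of_restrict p hl ho h1 h2 hne hb hz'.1,
        zSplitIIQ_of_restrict p hl ho h1 h2 hne hb hz'.2.1,
        zSplitI_of_restrict p hl ho h1 h2 hne hb hz'.2.2.1,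
        zSplitIQ_of_restrict p hl ho h1 h2 hne hb hz'.2.2.2⟩
    rcases Set.mem_insert_iff.1 hy with hya | hy'
    · -- the new leaf: K8 and the Q-side from its attachment vertex `x`
      have hx4 := hold x hx
      rw [hya]
      exact ⟨zSplitII_of_leaf_at p hp hl o a₁ a₂ b ho h1 h2 hb hx4.1 hx4.2.1,
        zSplitIIQ_of_leaf_at p hp hl o a₁ a₂ b ho h1 h2 hb hx4.2.1,
        zSplitI_of_leaf_at p hp hl o a₁ a₂ b ho h1 h2 hb hx4.2.2.1 hx4.2.2.2,
        zSplitIQ_of_leaf_at p hp hl o a₁ a₂ b ho h1 h2 hb hx4.2.2.2⟩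
    · exact hold y hy'

variable {E : Type u} [Fintype E] [DecidableEq E] {ends : E → Sym2 V} {o a₁ a₂ b v y : V} {S : Set V}

/-- **`(J1₁)` at every vertex of a pendant tree** at an anchor closed on the four forms. -/
theorem jOneOne_of_pendantTree (P : (E : Type u) → (E → Sym2 V) → V → Prop)
    (hP : ∀ (E : Type u) [Fintype E] [DecidableEq E] (ends : E → Sym2 V) (p : E → R), IsProbVec p →
      ∀ v, P E ends v → FourForms p ends o a₁ a₂ v b)
    {n : ℕ} (p : E → R) (hp : IsProbVec p) (h : IsPendantTreeAt P o a₁ a₂ b n E ends v S) (hy : y ∈ S) :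
    JOneOne p ends o a₁ a₂ y b :=
  let h4 := fourForms_of_pendantTree P o a₁ a₂ b hP n E ends p hp v S h y hy
  jOneOne_of_i_of_ii p ends o a₁ a₂ y b h4.2.2.1 h4.1

/-- **`(J1)` at every vertex of a pendant tree** at an anchor closed on the four forms for both orders
of the roots. -/
theorem jOne_of_pendantTree (P : (E : Type u) → (E → Sym2 V) → V → Prop)
    (hP : ∀ (E : Type u) [Fintype E] [DecidableEq E] (ends : E → Sym2 V) (p : E → R), IsProbVec p →
      ∀ v, P E ends v → FourForms p ends o a₁ a₂ v b)
    (hP' : ∀ (E : Type u) [Fintype E] [DecidableEq E] (ends : E → Sym2 V) (p : E → R), IsProbVec p →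
      ∀ v, P E ends v → FourForms p ends o a₂ a₁ v b)
    {n : ℕ} (p : E → R) (hp : IsProbVec p) (h : IsPendantTreeAt P o a₁ a₂ b n E ends v S) (hy : y ∈ S) :
    JOne p ends o a₁ a₂ y b :=
  jOne_of_jOneOne_of_mirror p ends o a₁ a₂ y b (jOneOne_of_pendantTree P hP p hp h hy)
    (jOneOne_of_pendantTree P hP' p hp (IsPendantTreeAt.swap P o a₁ a₂ b n E ends v S h) hy)

/-- **`(RV)` at every vertex of a pendant tree** (when the required-vertex world has mass). -/
theorem rv_of_pendantTree (P : (E : Type u) → (E → Sym2 V) → V → Prop)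
    (hP : ∀ (E : Type u) [Fintype E] [DecidableEq E] (ends : E → Sym2 V) (p : E → R), IsProbVec p →
      ∀ v, P E ends v → FourForms p ends o a₁ a₂ v b)
    {n : ℕ} (p : E → R) (hp : IsProbVec p) (h : IsPendantTreeAt P o a₁ a₂ b n E ends v S) (hy : y ∈ S)
    (hT : 0 < prob p (Tp ends a₁ a₂ y)) : RV p ends o a₁ a₂ y b :=
  (rv_iff_ii p ends o a₁ a₂ y b hT).2 (fourForms_of_pendantTree P o a₁ a₂ b hP n E ends p hp v S h y hy).1

end TreeTheorem

section PathIsTree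
variable {V : Type*}

/-- **A pendant path is a pendant tree with one branch**: when the anchor predicate gives the anchor an
edge, the vertices of a pendant path of `n` edges from `v` to `a₃` form a pendant tree of `n` edges at `v`
containing `a₃`. -/
theorem IsPendantTreeAt.of_pendantPath (P : (E : Type u) → (E → Sym2 V) → V → Prop) (o a₁ a₂ b : V)
    (hPedge : ∀ (E : Type u) (ends : E → Sym2 V) (v : V), P E ends v → ∃ e, v ∈ ends e) :
    ∀ (n : ℕ) (E : Type u) [Fintype E] [DecidableEq E] (ends : E → Sym2 V) (v a₃ : V),
      IsPendantPathAt P o a₁ a₂ b n E ends v a₃ →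
        ∃ S : Set V, IsPendantTreeAt P o a₁ a₂ b n E ends v S ∧ a₃ ∈ S := by
  intro n
  induction n with
  | zero =>
    intro E _ _ ends v a₃ h
    obtain ⟨rfl, hPv⟩ := h
    exact ⟨{a₃}, ⟨rfl, hPv⟩, Set.mem_singleton a₃⟩
  | succ n ih =>
    intro E _ _ ends v a₃ h
    obtain ⟨x, e₀, hl, ho, h1, h2, hb, hpath⟩ := h
    obtain ⟨S', htree, hx⟩ := ih {e : E // e ≠ e₀} (restrictEnds ends e₀) v x hpath
    refine ⟨insert a₃ S', ⟨x, a₃, e₀, S', hl, ho, h1, h2, hb, hx, ?_, rfl, htree⟩, Set.mem_insert a₃ S'⟩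
    -- `a₃` is not in the smaller tree: it has no edge in `G − e₀`, while every vertex of `S'` has one
    intro ha₃
    have hedge : ∃ e : {e : E // e ≠ e₀}, a₃ ∈ restrictEnds ends e₀ e := by
      by_cases hav : a₃ = v
      · -- the anchor has an edge in the fully restricted graph, hence in `G − e₀`
        rw [hav]
        exact IsPendantTreeAt.anchor_edge P o a₁ a₂ b hPedge n _ _ v S' htree
      · exact IsPendantTreeAt.exists_edge P o a₁ a₂ b n _ _ v S' htree a₃ ha₃ hav
    obtain ⟨e, he⟩ := hedge
    exact e.2 (hl.unique e.1 he)

end PathIsTree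

end CaseOne

end Summit.Ventures.PercRepro2
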